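import Literature.AlgebraicGeometry.Motives.AbelianVarietyFGSubfieldDescentTwoDivisors
import Literature.AlgebraicGeometry.Motives.AbelianVarietyTranslationInvariantClassBaseChange
import Literature.AlgebraicGeometry.Motives.AbelianVarietyWeilDivTransporter
import Literature.AlgebraicGeometry.Motives.AbelianVarietyKThetaCardFieldChange
import Literature.AlgebraicGeometry.Motives.CartierDivisorAmpleSpread
import Literature.AlgebraicGeometry.Motives.AbelianVarietyBaseChangeTowerFst
import Literature.AlgebraicGeometry.Motives.AbelianVarietyWeilPairingAlgClosure
import Literature.AlgebraicGeometry.Motives.AbelianVarietyAutBaseChangeTransfer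
import Literature.FieldTheory.AlgClosed.EmbeddingIntoComplex
import Mathlib.FieldTheory.AlgebraicClosure
import Literature.AlgebraicGeometry.Motives.AbelianVarietyWeilPairingDivisorClass
import Literature.AlgebraicGeometry.Motives.AbelianVarietyWeilPairingPullback
import Literature.AlgebraicGeometry.Motives.AbelianVarietyPicZeroOfAmple
import HarnessLib

/-!
# `φ_Θ : A(Ω) → Pic⁰(A)(Ω)` is onto for `Θ` ample over ANY algebraically closed field `Ω` of characteristic `0`
# ([MumfordAV1970] §8 Theorem 1, by transport from `ℂ`)

Layer `Literature/AlgebraicGeometry/Motives`, namespace `Literature.AlgebraicGeometry.Motives.AbelianVariety`.  THEOREMS ONLY (no definition, no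
named fact, no instance, no notation, no `sorry`).  Cell `hodgecm-mathlib` (D-0151) FLOOR 0 ∕ P1, F-3 (M) book, (Mc) input (H0) (census
`B-provers/B-p09/g17/CENSUS-F3Mc-H0-transport.B-p09g17.md`, file 4 of 5 = the ASSEMBLY).

* §1 **`exists_linEquiv_weilDiv_of_forall_translate_linEquiv_of_complex (hℂ) {Ω} [IsAlgClosed Ω] [CharZero Ω] (X : AbelianVariety Ω) (hΘ : Θ.IsAmple) (D)
  (hD : ∀ x : X.Points Ω, (D.pullback (X.translation x).left).LinEquiv D) : ∃ a, D.LinEquiv (X.weilDiv Θ a)`** — GIVEN the statement over `ℂ`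
  (hypothesis `hℂ` in the exact shape of the ℂ-head ★ `exists_linEquiv_weilDiv_of_forall_translate_linEquiv`; the transport is independent of the analysis).
  TRANSPORT (the device of ★ `h0_sq_eq_natCard_KTheta_of_complex` and ★ `PolarizedTripleRigidityDescent`): descend `(X, Θ, D)` to `k₁ = ℚ(s)` (★
  `exists_finset_intermediateField_descent_end_divisor₂`), spread the ampleness (★ `IsAmple.exists_finset_forall_isAmple_classPullback`), `K₂ ⊆ Ω` the
  algebraic closure of `k₁(s′)` in `Ω` (countable, algebraically closed), `σ : K₂ ↪ ℂ` (★ `nonempty_ringHom_complex_of_countable`); `[D] ∈ Pic⁰`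
  descends to `K₂`-points (★ `translation_left_comp_baseChangeFst`, «`Pic(B) ↪ Pic(B_L)`» ★ `linEquiv_zero_of_classPullback_baseChangeAlongFst`) and
  ascends to ALL `ℂ`-points (★ `pullback_translation_linEquiv_baseChange_of_isAlgClosed`, [MumfordAV1970] §8 (iv)); the ℂ-point `a` given by `hℂ`
  descends to a `K₂`-point (★ transporter `exists_linEquiv_weilDiv_of_baseChange`) and is carried up to `Ω` (★ `weilDiv_pullback_sameDivisor` along the
  isomorphisms `(B₁ ⊗ K₂) ⊗ Ω ≅ B₁ ⊗ Ω ≅ X`).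
* §2 **`exists_linEquiv_weilDiv_of_forall_translate_linEquiv_of_isAlgClosed`** — UNCONDITIONAL, plugging the ★ ℂ-head by name.

HC_CM is proved only modulo the 7 printed citations until rung 0 closes; nothing here bears on a summit statement.

## References
* [MumfordAV1970] D. Mumford, *Abelian Varieties* (1970), §8 Theorem 1 (p. 77), §8 (i)–(iv) (pp. 74–75), §6 Application 3 (p. 64).
* [Milne1986AbelianVarieties] J. S. Milne, *Abelian Varieties* (1986), §20 Rem. 20.9 (models over finitely generated fields).
* [GortzWedhorn2023] U. Görtz, T. Wedhorn, *Algebraic Geometry II* (2023), Thm. 24.66 (1) (p. 405), Def. 27.1 (pp. 604–605).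
-/

noncomputable section

set_option backward.isDefEq.respectTransparency false

open CategoryTheory CategoryTheory.Limits AlgebraicGeometry Opposite TopologicalSpace Function

namespace Literature.AlgebraicGeometry.Motives

namespace AbelianVariety

open Literature.AlgebraicGeometry.AbelianVarieties Literature.AlgebraicGeometry.AbelianVarieties.AbelianVariety
open scoped MonObj

/-! ## §0 Plumbing: translation-invariance and Weil divisors along an isomorphism of abelian varieties -/

section Plumbing

variable {k : Type} [Field k]

/-- Translation-invariance of a class moves along an isomorphism `j : B ≅ X` of abelian varieties: if `t_x^*D ∼ D` for all `x ∈ X(k)` then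
`t_P^*(j^*D) ∼ j^*D` for all `P ∈ B(k)` (`t_P ≫ j = j ≫ t_{j P}`, ★ `translation_comp_hom`). [cite: GortzWedhorn2023, Def. 27.1 (pp. 604–605)] -/
theorem forall_translate_linEquiv_pullback_hom {B X : AbelianVariety k} (j : B ⟶ X) [IsDominant (Hom.toSchemeHom j)]
    {D : CartierDivisor X.X.left} (hD : ∀ x : X.Points k, (D.pullback (X.translation x).left).LinEquiv D) (P : B.Points k) :
    ((D.pullback (Hom.toSchemeHom j)).pullback (B.translation P).left).LinEquiv (D.pullback (Hom.toSchemeHom j)) := by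
  have hc : (B.translation P).left ≫ Hom.toSchemeHom j = Hom.toSchemeHom j ≫ (X.translation (P ≫ j.hom.hom.hom)).left := by
    have := congrArg (fun f => Over.Hom.left f) (translation_comp_hom j P)
    simpa only [Over.comp_left] using this
  haveI : IsDominant ((B.translation P).left ≫ Hom.toSchemeHom j) := inferInstance
  haveI : IsDominant (Hom.toSchemeHom j ≫ (X.translation (P ≫ j.hom.hom.hom)).left) := inferInstance
  refine (((CartierDivisor.pullback_pullback_sameDivisor D (Hom.toSchemeHom j) (B.translation P).left).trans
    (CartierDivisor.pullback_congr_sameDivisor D hc)).trans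
    (CartierDivisor.pullback_pullback_sameDivisor D (X.translation (P ≫ j.hom.hom.hom)).left (Hom.toSchemeHom j)).symm).linEquiv.trans ?_
  exact (hD (P ≫ j.hom.hom.hom)).pullback (Hom.toSchemeHom j)

/-- Translation-invariance of a class is a class invariant. [cite: MumfordAV1970, §8 (i) (p. 74)] -/
theorem forall_translate_linEquiv_congr {B : AbelianVariety k} {D E : CartierDivisor B.X.left} (h : D.LinEquiv E)
    (hD : ∀ x : B.Points k, (D.pullback (B.translation x).left).LinEquiv D) (x : B.Points k) :
    (E.pullback (B.translation x).left).LinEquiv E :=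
  ((h.symm.pullback _).trans (hD x)).trans h

end Plumbing

/-! ## §1 The transport -/

/-- **[MumfordAV1970] §8 Theorem 1 over ANY algebraically closed field of characteristic `0`, from the statement over `ℂ`**: for `X`
an abelian variety over `Ω = Ω̄`, `char Ω = 0`, `Θ` ample and `D` with `t_x^*D ∼ D` for all `x ∈ X(Ω)`, there is `a ∈ X(Ω)` with
`D ∼ t_a^*Θ − Θ` — GIVEN the same statement over `ℂ` (hypothesis `hℂ`).  See the module docstring for the transport.
[cite: MumfordAV1970, §8 Theorem 1 (p. 77)] [cite: Milne1986AbelianVarieties, §20 Rem. 20.9] -/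
theorem exists_linEquiv_weilDiv_of_forall_translate_linEquiv_of_complex
    (hℂ : ∀ (B : AbelianVariety ℂ) (Θ : CartierDivisor B.X.left), Θ.IsAmple → ∀ D : CartierDivisor B.X.left,
      (∀ x : B.Points ℂ, (D.pullback (B.translation x).left).LinEquiv D) → ∃ a : B.Points ℂ, D.LinEquiv (B.weilDiv Θ a))
    {Ω : Type} [Field Ω] [IsAlgClosed Ω] [CharZero Ω] (X : AbelianVariety Ω) {Θ : CartierDivisor X.X.left} (hΘ : Θ.IsAmple)
    (D : CartierDivisor X.X.left) (hD : ∀ x : X.Points Ω, (D.pullback (X.translation x).left).LinEquiv D) :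
    ∃ a : X.Points Ω, D.LinEquiv (X.weilDiv Θ a) := by
  classical
  -- §1 the model over the finitely generated field `k₁ := ℚ(s)`
  obtain ⟨s, hs⟩ := exists_finset_intermediateField_descent_end_divisor₂ (F := ℚ) X (J := Fin 0) (fun i => Fin.elim0 i) Θ D
  let k₁ : IntermediateField ℚ Ω := IntermediateField.adjoin ℚ (↑s : Set Ω)
  obtain ⟨B₁, ε, -, _, _, Θ₁, D₁, -, hΘ₁, hD₁⟩ := hs k₁ (IntermediateField.subset_adjoin ℚ _)
  haveI : IsIso (Hom.toSchemeHom ε.hom) :=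
    ⟨Hom.toSchemeHom ε.inv, by change Hom.toSchemeHom (ε.hom ≫ ε.inv) = _; rw [ε.hom_inv_id]; rfl, by
      change Hom.toSchemeHom (ε.inv ≫ ε.hom) = _; rw [ε.inv_hom_id]; rfl⟩
  haveI := isDominant_toSchemeHom_iso_hom ε
  let pr₁Ω : (B₁.baseChange Ω).X.left ⟶ B₁.X.left := pullback.fst B₁.X.hom (bcSpec k₁ Ω)
  have hpr₁Ω : pr₁Ω = pullback.fst B₁.X.hom (bcSpec k₁ Ω) := rfl
  have hdomΩ : IsDominant pr₁Ω := by
    change IsDominant (baseChangeHomFst (algebraMap k₁ Ω) B₁.X)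
    exact isDominant_baseChangeHomFst_along (algebraMap k₁ Ω) B₁
  haveI := hdomΩ
  have hΘ₁' : (Θ.pullback (Hom.toSchemeHom ε.hom)).LinEquiv (Θ₁.pullback pr₁Ω) :=
    ((CartierDivisor.classPullback_linEquiv_pullback (Hom.toSchemeHom ε.hom) Θ).symm.trans hΘ₁).trans
      (CartierDivisor.classPullback_linEquiv_pullback pr₁Ω Θ₁)
  have hD₁' : (D.pullback (Hom.toSchemeHom ε.hom)).LinEquiv (D₁.pullback pr₁Ω) :=
    ((CartierDivisor.classPullback_linEquiv_pullback (Hom.toSchemeHom ε.hom) D).symm.trans hD₁).trans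
      (CartierDivisor.classPullback_linEquiv_pullback pr₁Ω D₁)
  have hampΩ : (Θ₁.pullback pr₁Ω).IsAmple := hΘ₁'.isAmple (hΘ.pullback (Hom.toSchemeHom ε.hom))
  have hampΩ' : (Θ₁.classPullback (pullback.fst B₁.X.hom (bcSpec k₁ Ω))).IsAmple :=
    (CartierDivisor.classPullback_linEquiv_pullback pr₁Ω Θ₁).symm.isAmple hampΩ
  -- §2 spread the ampleness to a finite stage `s′`
  obtain ⟨s', hs'⟩ := CartierDivisor.IsAmple.exists_finset_forall_isAmple_classPullback B₁.X Θ₁ hampΩ'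
  -- §3 `K₂ :=` the algebraic closure of `k₁(s′)` in `Ω`: countable, algebraically closed, containing `s′`
  let k₁' : IntermediateField (↥k₁) Ω := IntermediateField.adjoin (↥k₁) (↑s' : Set Ω)
  let K₂ : IntermediateField (↥k₁) Ω := (algebraicClosure (↥k₁') Ω).restrictScalars (↥k₁)
  haveI : IsAlgClosed (↥K₂) := (IsAlgClosure.isAlgClosed (↥k₁') (K := ↥(algebraicClosure (↥k₁') Ω)) :)
  haveI : CharZero (↥K₂) := (RingHom.charZero_iff (algebraMap (↥K₂) Ω).injective).mpr inferInstance
  haveI : FaithfulSMul (↥k₁') (↥(algebraicClosure (↥k₁') Ω)) :=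
    (faithfulSMul_iff_algebraMap_injective _ _).mpr fun x y hxy =>
      Subtype.ext (congrArg (fun z : ↥(algebraicClosure (↥k₁') Ω) => (z : Ω)) hxy)
  haveI : Module.IsTorsionFree (↥k₁') (↥(algebraicClosure (↥k₁') Ω)) := FaithfulSMul.to_isTorsionFree ..
  haveI : Countable (↥K₂) := by
    rw [← Cardinal.mk_le_aleph0_iff]
    have h₁ : Cardinal.mk (↥k₁) ≤ Cardinal.aleph0 :=
      (IntermediateField.cardinalMk_adjoin_le ℚ (↑s : Set Ω)).trans (by simp)
    have h₂ : Cardinal.mk (↥k₁') ≤ Cardinal.aleph0 :=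
      (IntermediateField.cardinalMk_adjoin_le (↥k₁) (↑s' : Set Ω)).trans (by simp [h₁])
    exact (Algebra.IsAlgebraic.cardinalMk_le_max (↥k₁') (↥(algebraicClosure (↥k₁') Ω))).trans (by simp [h₂])
  have hsub : (↑s' : Set Ω) ⊆ Set.range (algebraMap (↥K₂) Ω) := by
    intro x hx
    have hx₁ : x ∈ k₁' := IntermediateField.subset_adjoin (↥k₁) _ hx
    exact ⟨⟨x, IntermediateField.algebraMap_mem (algebraicClosure (↥k₁') Ω) ⟨x, hx₁⟩⟩, rfl⟩
  have hampK₂ := hs' (↥K₂) hsub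
  let B₂ : AbelianVariety (↥K₂) := B₁.baseChange (↥K₂)
  let pr₁₂ : B₂.X.left ⟶ B₁.X.left := pullback.fst B₁.X.hom (bcSpec k₁ (↥K₂))
  have hpr₁₂ : pr₁₂ = pullback.fst B₁.X.hom (bcSpec k₁ (↥K₂)) := rfl
  have hdom₂ : IsDominant pr₁₂ := by
    change IsDominant (baseChangeHomFst (algebraMap k₁ (↥K₂)) B₁.X)
    exact isDominant_baseChangeHomFst_along (algebraMap k₁ (↥K₂)) B₁
  haveI := hdom₂
  let Θ₂ : CartierDivisor B₂.X.left := Θ₁.pullback pr₁₂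
  let D₂ : CartierDivisor B₂.X.left := D₁.pullback pr₁₂
  have hΘ₂ : Θ₂.IsAmple := (CartierDivisor.classPullback_linEquiv_pullback pr₁₂ Θ₁).isAmple hampK₂
  -- the tower `(B₁ ⊗ K₂) ⊗ Ω ≅ B₁ ⊗ Ω` and the projection `pr₂Ω`
  let pr₂Ω : (B₂.baseChange Ω).X.left ⟶ B₂.X.left := pullback.fst B₂.X.hom (bcSpec (↥K₂) Ω)
  have hpr₂Ω : pr₂Ω = pullback.fst B₂.X.hom (bcSpec (↥K₂) Ω) := rfl
  have hdom₂Ω : IsDominant pr₂Ω := by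
    change IsDominant (baseChangeHomFst (algebraMap (↥K₂) Ω) B₂.X)
    exact isDominant_baseChangeHomFst_along (algebraMap (↥K₂) Ω) B₂
  haveI := hdom₂Ω
  let τ : B₂.baseChange Ω ≅ B₁.baseChange Ω := baseChangeTowerIso k₁ (↥K₂) Ω B₁
  haveI := isDominant_toSchemeHom_iso_hom τ
  have sqτ : Hom.toSchemeHom τ.hom ≫ pr₁Ω = pr₂Ω ≫ pr₁₂ := toSchemeHom_baseChangeTowerIso_hom_comp_fst k₁ (↥K₂) Ω B₁
  haveI : IsDominant (Hom.toSchemeHom τ.hom ≫ pr₁Ω) := inferInstance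
  haveI : IsDominant (pr₂Ω ≫ pr₁₂) := inferInstance
  have htow : ∀ F₁ : CartierDivisor B₁.X.left,
      ((F₁.pullback pr₁Ω).pullback (Hom.toSchemeHom τ.hom)).LinEquiv ((F₁.pullback pr₁₂).pullback pr₂Ω) := fun F₁ =>
    (((CartierDivisor.pullback_pullback_sameDivisor F₁ pr₁Ω (Hom.toSchemeHom τ.hom)).trans
      (CartierDivisor.pullback_congr_sameDivisor F₁ sqτ)).trans
      (CartierDivisor.pullback_pullback_sameDivisor F₁ pr₁₂ pr₂Ω).symm).linEquiv
  -- the composite isomorphism `j : B₂ ⊗ Ω ≅ X` and the classes of `Θ`, `D` along it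
  let j : B₂.baseChange Ω ⟶ X := τ.hom ≫ ε.hom
  have hj : Hom.toSchemeHom j = Hom.toSchemeHom τ.hom ≫ Hom.toSchemeHom ε.hom := rfl
  haveI : IsDominant (Hom.toSchemeHom j) := by rw [hj]; infer_instance
  haveI : IsDominant (Hom.toSchemeHom τ.hom ≫ Hom.toSchemeHom ε.hom) := inferInstance
  have hjF : ∀ (F : CartierDivisor X.X.left) (F₁ : CartierDivisor B₁.X.left),
      (F.pullback (Hom.toSchemeHom ε.hom)).LinEquiv (F₁.pullback pr₁Ω) →
      (F.pullback (Hom.toSchemeHom j)).LinEquiv ((F₁.pullback pr₁₂).pullback pr₂Ω) := fun F F₁ h =>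
    ((CartierDivisor.pullback_congr_sameDivisor F hj).trans
      (CartierDivisor.pullback_pullback_sameDivisor F (Hom.toSchemeHom ε.hom) (Hom.toSchemeHom τ.hom)).symm).linEquiv.trans
      ((h.pullback _).trans (htow F₁))
  have hΘj := hjF Θ Θ₁ hΘ₁'
  have hDj := hjF D D₁ hD₁'
  -- §4 `[D₂] ∈ Pic⁰` on `K₂`-points: down from `Ω` along `j` and `pr₂Ω`
  have hDΩ : ∀ P : (B₂.baseChange Ω).Points Ω,
      (((D₂.pullback pr₂Ω)).pullback ((B₂.baseChange Ω).translation P).left).LinEquiv (D₂.pullback pr₂Ω) := fun P =>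
    forall_translate_linEquiv_congr hDj (forall_translate_linEquiv_pullback_hom j hD) P
  obtain ⟨φ, hφinj, hφ, -⟩ := exists_monoidHom_points_baseChange Ω B₂
  have hover : ∀ Q : B₂.Points (↥K₂), (φ Q).left ≫ pr₂Ω = bcSpec (↥K₂) Ω ≫ Q.left := by
    intro Q
    rw [hφ, hpr₂Ω, pointsMulEquiv_apply, pointsEquiv_apply_left_comp_fst, AlgPoints.extendScalars_apply, Over.comp_left,
      AlgPoints.specOverMap_left]
  have hsame : ∀ (Q : B₂.Points (↥K₂)) (F : CartierDivisor B₂.X.left),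
      ((B₂.baseChange Ω).weilDiv (F.pullback pr₂Ω) (φ Q)).SameDivisor ((B₂.weilDiv F Q).pullback pr₂Ω) := by
    intro Q F
    have hc : ((B₂.baseChange Ω).translation (φ Q)).left ≫ pr₂Ω = pr₂Ω ≫ (B₂.translation Q).left :=
      translation_left_comp_baseChangeFst Ω B₂ pr₂Ω hpr₂Ω (φ Q) Q (hover Q)
    haveI : IsDominant (((B₂.baseChange Ω).translation (φ Q)).left ≫ pr₂Ω) := inferInstance
    haveI : IsDominant (pr₂Ω ≫ (B₂.translation Q).left) := inferInstance
    unfold weilDiv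
    refine CartierDivisor.SameDivisor.trans ?_ (CartierDivisor.pullback_add_sameDivisor _ _ pr₂Ω).symm
    refine CartierDivisor.SameDivisor.add ?_ (CartierDivisor.pullback_neg_sameDivisor _ _).symm
    exact ((CartierDivisor.pullback_pullback_sameDivisor F pr₂Ω _).trans (CartierDivisor.pullback_congr_sameDivisor F hc)).trans
      (CartierDivisor.pullback_pullback_sameDivisor F _ pr₂Ω).symm
  have hD₂ : ∀ x : B₂.Points (↥K₂), (D₂.pullback (B₂.translation x).left).LinEquiv D₂ := by
    intro x
    -- `t_x^*D₂ − D₂` pulled back to `B₂ ⊗ Ω` is `t_{x_Ω}^*(D₂ ⊗ Ω) − D₂ ⊗ Ω ∼ 0`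
    have h1 : ((B₂.weilDiv D₂ x).pullback pr₂Ω).LinEquiv 0 := by
      refine (hsame x D₂).linEquiv.symm.trans ?_
      exact (hDΩ (φ x)).add_neg
    have h2 : ((B₂.weilDiv D₂ x).classPullback pr₂Ω).LinEquiv 0 :=
      (CartierDivisor.classPullback_linEquiv_pullback pr₂Ω _).trans h1
    exact CartierDivisor.LinEquiv.of_add_neg
      (linEquiv_zero_of_classPullback_baseChangeAlongFst (algebraMap (↥K₂) Ω) B₂ pr₂Ω hpr₂Ω _ h2)
  -- §5 the embedding `σ : K₂ ↪ ℂ`, the base change `B₂ ⊗_σ ℂ`, and `[D₂ ⊗ ℂ] ∈ Pic⁰` at EVERY `ℂ`-point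
  obtain ⟨σ⟩ := Literature.FieldTheory.AlgClosed.nonempty_ringHom_complex_of_countable (↥K₂)
  letI : Algebra (↥K₂) ℂ := σ.toAlgebra
  let prℂ : (B₂.baseChange ℂ).X.left ⟶ B₂.X.left := pullback.fst B₂.X.hom (bcSpec (↥K₂) ℂ)
  have hprℂ : prℂ = pullback.fst B₂.X.hom (bcSpec (↥K₂) ℂ) := rfl
  have hdomℂ : IsDominant prℂ := by
    change IsDominant (baseChangeHomFst (algebraMap (↥K₂) ℂ) B₂.X)
    exact isDominant_baseChangeHomFst_along (algebraMap (↥K₂) ℂ) B₂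
  haveI := hdomℂ
  haveI : IsAffineHom (bcSpec (↥K₂) ℂ) := isAffineHom_of_isAffine _
  haveI : IsAffineHom prℂ := by rw [hprℂ]; exact MorphismProperty.pullback_fst _ _ inferInstance
  have hΘℂ : (Θ₂.pullback prℂ).IsAmple := hΘ₂.pullback prℂ
  have hDℂ : ∀ y : (B₂.baseChange ℂ).Points ℂ, ((D₂.pullback prℂ).pullback ((B₂.baseChange ℂ).translation y).left).LinEquiv (D₂.pullback prℂ) :=
    pullback_translation_linEquiv_baseChange_of_isAlgClosed ℂ B₂ hD₂ prℂ hprℂ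
  -- §6 the ℂ-brick and the transporter: a `K₂`-point `z` with `D₂ ∼ t_z^*Θ₂ − Θ₂`
  obtain ⟨a, ha⟩ := hℂ (B₂.baseChange ℂ) (Θ₂.pullback prℂ) hΘℂ (D₂.pullback prℂ) hDℂ
  obtain ⟨z, hz⟩ := B₂.exists_linEquiv_weilDiv_of_baseChange ℂ Θ₂ D₂ prℂ hprℂ a ha
  -- §7 up to `Ω`: `D₂ ⊗ Ω ∼ t_{z_Ω}^*(Θ₂ ⊗ Ω) − Θ₂ ⊗ Ω`, then along `j` to `X`
  have hzΩ : (D₂.pullback pr₂Ω).LinEquiv ((B₂.baseChange Ω).weilDiv (Θ₂.pullback pr₂Ω) (φ z)) :=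
    (hz.pullback pr₂Ω).trans (hsame z Θ₂).linEquiv.symm
  let aX : X.Points Ω := AlgPoints.map j.hom.hom.hom (φ z)
  refine ⟨aX, ?_⟩
  -- `j^*(t_{aX}^*Θ − Θ) ∼ t_{z_Ω}^*(j^*Θ) − j^*Θ ∼ t_{z_Ω}^*(Θ₂ ⊗ Ω) − Θ₂ ⊗ Ω ∼ D₂ ⊗ Ω ∼ j^*D`
  have hW : ((X.weilDiv Θ aX).pullback (Hom.toSchemeHom j)).LinEquiv (D.pullback (Hom.toSchemeHom j)) :=
    (((weilDiv_pullback_sameDivisor j Θ (φ z)).linEquiv.symm.trans (weilDiv_congr_linEquiv _ hΘj (φ z))).trans hzΩ.symm).trans hDj.symm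
  -- pull back along `j⁻¹`
  haveI : IsIso (Hom.toSchemeHom τ.hom) :=
    ⟨Hom.toSchemeHom τ.inv, by change Hom.toSchemeHom (τ.hom ≫ τ.inv) = _; rw [τ.hom_inv_id]; rfl, by
      change Hom.toSchemeHom (τ.inv ≫ τ.hom) = _; rw [τ.inv_hom_id]; rfl⟩
  haveI : IsIso (Hom.toSchemeHom j) := by rw [hj]; exact IsIso.comp_isIso
  haveI : IsDominant (inv (Hom.toSchemeHom j)) := inferInstance
  haveI : IsDominant (inv (Hom.toSchemeHom j) ≫ Hom.toSchemeHom j) := inferInstance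
  have hback : ∀ F : CartierDivisor X.X.left, ((F.pullback (Hom.toSchemeHom j)).pullback (inv (Hom.toSchemeHom j))).LinEquiv F := fun F =>
    (((CartierDivisor.pullback_pullback_sameDivisor F (Hom.toSchemeHom j) (inv (Hom.toSchemeHom j))).trans
      (CartierDivisor.pullback_congr_sameDivisor F (IsIso.inv_hom_id (Hom.toSchemeHom j)))).trans
      (CartierDivisor.pullback_id_sameDivisor F)).linEquiv
  exact ((hback D).symm.trans ((hW.symm).pullback _)).trans (hback _)

/-! ## §2 Unconditionally: plugging the ℂ-head -/

/-- **[MumfordAV1970] §8 Theorem 1 — `φ_Θ : X(Ω) → Pic⁰(X)(Ω)`, `a ↦ [t_a^*Θ − Θ]`, is SURJECTIVE for `Θ` ample, over ANY algebraically closed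
field `Ω` of characteristic `0`**: every Cartier divisor whose class is invariant under all translations is linearly equivalent to `t_a^*Θ − Θ` for
some `a ∈ X(Ω)`.  (§1 + the ℂ-head ★ `exists_linEquiv_weilDiv_of_forall_translate_linEquiv`, Appell–Humbert.)
[cite: MumfordAV1970, §8 Theorem 1 (p. 77)] -/
theorem exists_linEquiv_weilDiv_of_forall_translate_linEquiv_of_isAlgClosed {Ω : Type} [Field Ω] [IsAlgClosed Ω] [CharZero Ω]
    (X : AbelianVariety Ω) {Θ : CartierDivisor X.X.left} (hΘ : Θ.IsAmple) (D : CartierDivisor X.X.left)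
    (hD : ∀ x : X.Points Ω, (D.pullback (X.translation x).left).LinEquiv D) :
    ∃ a : X.Points Ω, D.LinEquiv (X.weilDiv Θ a) :=
  exists_linEquiv_weilDiv_of_forall_translate_linEquiv_of_complex
    (fun B _ hΘ' D' hD' => B.exists_linEquiv_weilDiv_of_forall_translate_linEquiv hΘ' D' hD') X hΘ D hD

end AbelianVariety

end Literature.AlgebraicGeometry.Motives

end
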